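/-
Copyright (c) 2026. All rights reserved.
Released under Apache 2.0 license as described in the file LICENSE.
-/
import Mathlib
import Literature.Analysis.FunctionSpaces.PlancherelL1L2
import HarnessLib

/-!
# Band-limited parts are Lipschitz

`HANDOFF/prove-1` gen15, ATTEMPT-22 (S22-h), companion of `HandoffSlavedEL` / `HandoffLatticeTailAE`:
the inverse Fourier integral of an `h ∈ L¹` with `∫ |ξ|·‖h ξ‖ dξ < ∞` is Lipschitz with constant
`2π ∫ |ξ|·‖h ξ‖` (`dist_fourierInv_le`; the character bound is the tree's
`BoseGas.norm_fourierChar_sub_le`, re-derived locally); in particular the band-limited part `D_λF = 𝓕⁻(1_{|ξ|<λ}·𝓕F)`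
of any `F ∈ L¹` is Lipschitz on `ℝ` (`dist_bandLimit_le`). With L-EL (`HandoffSlavedEL`: a slaved
completion is `D_λF + α` a.e. on the inner zone) and `latticeTail_congr_ae` this puts slaved
completions of Lipschitz window data into the one-jump class of `HandoffLatticeTailJump` (THEOREM P:
their lattice tail is positive) after the a.e. modification — the assembly is left to a successor.
RH-free; nothing here bears on the truth of RH.
-/

set_option linter.dupNamespace false

noncomputable section

open MeasureTheory Set Complex
open scoped FourierTransform

namespace Summit.RiemannHypothesis.RiemannHypothesis.Theorems

namespace LatticeUncertainty.SlavedEL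

/-- **Inverse Fourier integrals with a first moment are Lipschitz**:
`‖𝓕⁻h x − 𝓕⁻h y‖ ≤ 2π (∫ |ξ|‖h ξ‖) |x − y|`. -/
theorem dist_fourierInv_le {h : ℝ → ℂ} (hh : Integrable h)
    (hm : Integrable (fun ξ ↦ |ξ| * ‖h ξ‖)) (x y : ℝ) :
    ‖𝓕⁻ h x - 𝓕⁻ h y‖ ≤ 2 * Real.pi * (∫ ξ, |ξ| * ‖h ξ‖) * |x - y| := by
  -- `‖𝐞 a − 𝐞 b‖ ≤ 2π|a − b|` (the tree's `BoseGas.norm_fourierChar_sub_le`, re-derived locally to keep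
  -- the imports light)
  have norm_fourierChar_sub_le : ∀ a b : ℝ,
      ‖(Real.fourierChar a : ℂ) - Real.fourierChar b‖ ≤ 2 * Real.pi * |a - b| := by
    intro a b
    have hab : (Real.fourierChar a : ℂ) = Real.fourierChar b * Real.fourierChar (a - b) := by
      rw [← Circle.coe_mul, ← AddChar.map_add_eq_mul]
      congr 2; ring
    rw [hab, ← mul_sub_one, norm_mul, Circle.norm_coe, one_mul, Real.fourierChar_apply]
    have : (((2 * Real.pi * (a - b) : ℝ) : ℂ) * Complex.I) =
        Complex.I * ((2 * Real.pi * (a - b) : ℝ) : ℂ) := by ring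
    rw [this]
    refine (Real.norm_exp_I_mul_ofReal_sub_one_le).trans (le_of_eq ?_)
    rw [Real.norm_eq_abs, abs_mul, abs_of_pos Real.two_pi_pos]
  have hint : ∀ z : ℝ, Integrable (fun v : ℝ ↦ Real.fourierChar (-(v * -z)) • h v) := by
    intro z
    refine Integrable.mono' hh.norm ?_ (ae_of_all _ fun v ↦ ?_)
    · exact (Real.continuous_fourierChar.comp (by fun_prop)).aestronglyMeasurable.smul
        hh.aestronglyMeasurable
    · rw [Circle.norm_smul]
  rw [Real.fourierInv_eq_fourier_neg, Real.fourierInv_eq_fourier_neg, Real.fourier_real_eq,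
    Real.fourier_real_eq, ← integral_sub (hint x) (hint y)]
  refine (norm_integral_le_integral_norm _).trans ?_
  have hbound : ∀ v : ℝ, ‖Real.fourierChar (-(v * -x)) • h v - Real.fourierChar (-(v * -y)) • h v‖
      ≤ 2 * Real.pi * |x - y| * (|v| * ‖h v‖) := by
    intro v
    rw [Circle.smul_def, Circle.smul_def, smul_eq_mul, smul_eq_mul, ← sub_mul, norm_mul]
    have h1 := norm_fourierChar_sub_le (-(v * -x)) (-(v * -y))
    have h2 : |(-(v * -x)) - (-(v * -y))| = |v| * |x - y| := by
      rw [← abs_mul]; congr 1; ring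
    rw [h2] at h1
    calc ‖(Real.fourierChar (-(v * -x)) : ℂ) - Real.fourierChar (-(v * -y))‖ * ‖h v‖
        ≤ 2 * Real.pi * (|v| * |x - y|) * ‖h v‖ := by gcongr
      _ = 2 * Real.pi * |x - y| * (|v| * ‖h v‖) := by ring
  refine (integral_mono_of_nonneg (ae_of_all _ fun v ↦ norm_nonneg _) (hm.const_mul _)
    (ae_of_all _ hbound)).trans (le_of_eq ?_)
  rw [integral_const_mul]; ring

/-- The first moment of the band piece `1_{|ξ|<λ}·𝓕F` is finite. -/
theorem integrable_abs_mul_band {F : ℝ → ℂ} (hF : Integrable F) (lam : ℝ) :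
    Integrable (fun ξ ↦ |ξ| * ‖{ξ : ℝ | |ξ| < lam}.indicator (𝓕 F) ξ‖) := by
  have hB : MeasurableSet {ξ : ℝ | |ξ| < lam} :=
    measurableSet_lt (continuous_abs.measurable) measurable_const
  have hc : Continuous (𝓕 F) := Literature.Analysis.FunctionSpaces.continuous_fourierIntegral hF
  have hsub : {ξ : ℝ | |ξ| < lam} ⊆ Icc (-lam) lam := fun ξ hξ ↦ by
    simp only [mem_setOf_eq, abs_lt] at hξ; exact ⟨hξ.1.le, hξ.2.le⟩
  have hIcc : IntegrableOn (fun ξ ↦ |ξ| * ‖𝓕 F ξ‖) {ξ : ℝ | |ξ| < lam} :=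
    ((continuous_abs.mul hc.norm).continuousOn.integrableOn_compact isCompact_Icc).mono_set hsub
  refine ((integrable_indicator_iff hB).mpr hIcc).congr (ae_of_all _ fun ξ ↦ ?_)
  by_cases hξ : ξ ∈ {ξ : ℝ | |ξ| < lam}
  · simp [indicator_of_mem hξ]
  · simp [indicator_of_notMem hξ]

/-- `𝓕F` is integrable on the (bounded) band `{|ξ| < λ}`. -/
theorem integrableOn_fourier_band {F : ℝ → ℂ} (hF : Integrable F) (lam : ℝ) :
    IntegrableOn (𝓕 F) {ξ : ℝ | |ξ| < lam} := by
  have hc : Continuous (𝓕 F) := Literature.Analysis.FunctionSpaces.continuous_fourierIntegral hF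
  have hsub : {ξ : ℝ | |ξ| < lam} ⊆ Icc (-lam) lam := fun ξ hξ ↦ by
    simp only [mem_setOf_eq, abs_lt] at hξ; exact ⟨hξ.1.le, hξ.2.le⟩
  exact (hc.continuousOn.integrableOn_compact isCompact_Icc).mono_set hsub

/-- **The band-limited part of an `L¹` function is Lipschitz.** -/
theorem dist_bandLimit_le {F : ℝ → ℂ} (hF : Integrable F) (lam x y : ℝ) :
    ‖𝓕⁻ ({ξ : ℝ | |ξ| < lam}.indicator (𝓕 F)) x - 𝓕⁻ ({ξ : ℝ | |ξ| < lam}.indicator (𝓕 F)) y‖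
      ≤ 2 * Real.pi * (∫ ξ, |ξ| * ‖{ξ : ℝ | |ξ| < lam}.indicator (𝓕 F) ξ‖) * |x - y| :=
  dist_fourierInv_le
    ((integrable_indicator_iff (measurableSet_lt continuous_abs.measurable measurable_const)).mpr
      (integrableOn_fourier_band hF lam)) (integrable_abs_mul_band hF lam) x y

end LatticeUncertainty.SlavedEL

end Summit.RiemannHypothesis.RiemannHypothesis.Theorems
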